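import Literature.MathematicalPhysics.QuantumFieldTheory.Balaban1983to89.B9Cor36GDirKnitAtCutField
import Literature.MathematicalPhysics.QuantumFieldTheory.Balaban1983to89.B9Cor36GCubeEntriesAtV

/-!
v1.1 (dag-n06-d g35, LOCATED-37): + ★★★`gDir_knit_entries_at_cutFieldU` — the α₀-UNIFORM edition (the auxiliary `α₀` quantified inside the universal block, constants chosen
before it; the original proof moved under it, over ✓`gDir_knit_at_cutFieldU`); `gDir_knit_entries_at_cutField` is re-proved as its corollary, statement unchanged; doc-only locator nicety «(2.51)–(2.55) pp. 232–233» (lit-balaban r06 A191).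

# `Balaban1983to89.B9Cor36GDirKnitEntriesAtCutField` — [Balaban1985BackgroundPropagators] COROLLARY 3.6 p. 408 AT ONE COVER CUBE □ FOR THE DIRICHLET BOND LETTER OF
# RECORD `G_□(Ṽ)` (p. 409 l. 1–5) AT THE SHARP-CUT SMALL FIELD `Ṽ = cutCfgS i T η A`: THE (3.42) ENTRIES OF THEOREM 3.3 WITH THE COVARIANT BOND DERIVATIVES AT `Ṽ` —
# `|G_□J|, |∇_ṼG_□J|, |∇*_ṼG_□J| (left), |Δ_ṼG_□J| ≦ B[(Lⁿη)², Lⁿη, Lⁿη, 1]e^{−δd}|J|` proved, `|G_□∇*_ṼJ| ≦ B·Lⁿη·e^{−δd}|J|` modulo its flat half — as conj-`b` block majorants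
# over the cube sequence's blocks, from F4's transferred flat entries by the `(Ṽ − 1)`-shift corrections of the bond derivative letters and the lattice Leibniz rule
# (seat dag-n06-c g34, FILE F5 of road (B5)'s rest; the Dirichlet twin of r05's G-F6a ✓`cor36_G_cube_entries_at_locCfg'`)

statement-level skeleton of published theorems with citation tags; proofs where landed; nothing here is a claim about the Yang–Mills mass gap

CITATION HEADER (lean-in-tree rule).  B9 = T. Bałaban, *Propagators for lattice gauge theories in a background field*, Commun. Math. Phys. **99** (1985)
389–434 [Balaban1985BackgroundPropagators] (held `paper:balaban1985-cmp99-background-propagators`; journal page = PDF page + 388): Cor. 3.6 p. 408 l. 1–10; Thm 3.1 (3.42)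
p. 397 («|(G′(U)λ)(x)|, |(∇_U G′(U)λ)(x)|, |(G′(U)∇\*_U λ)(x)|, |(Δ_U G′(U)λ)(x)| ≦ B₀[(Lʲη)², Lʲη, Lʲη, 1]e^{−δ₀d(y,y′)}|λ|»); Thm 3.3 p. 399 («with G′(U) replaced by G(U)
and λ replaced by a function J defined at bonds»); Thm 3.4 p. 400; p. 403 l. 1–9 and (3.70) p. 404 (`∇_{U′U} = ∇_U + (U′ − 1)`-terms); (3.3) p. 390, (3.8) p. 392, (3.23) p. 394;
(3.37) p. 396; (3.100) p. 413 (the lattice Leibniz rule); p. 398 remark («the choice of derivatives ∇_U, ∇\*_U is conventional»); p. 409 l. 1–5 («G_□(U)»).  [4] =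
[Balaban1984PropagatorsII] (2.51)–(2.55) pp. 232–233, Lemma 2.1 (2.60)–(2.63) p. 234, Prop. 2.6 (2.136) p. 247.  Rows B9.Cor3.6 × B9.Thm3.3 × B9.Eq3.42 (cells only; no row head changes).

WHY THIS FILE (cell `pub-ymgap`, node N06 [B9]; dag-n06-d g35's bundle ✓`CubeRowsGDirCY`).  The bundle's four rows are the (3.42) entries of `conj b(G_□(Ṽ)♯ℝ)` with def-Y's
COVARIANT bond letters AT `Ṽ`: `cdBₗ i Ṽ ν` (left), `cdsBₗ i Ṽ ν` (right), `lapBₗ i Ṽ`.  F4 (✓`gDir_knit_at_cutField`) delivers `IsUnit padΔ_{loc,□}(Ṽ)` and the three transferred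
LEFT entries of `G := GiK b i (TKnitCY i □ Ṽ) B = conj b(G_□(Ṽ)♯ℝ)` with the FLAT letters `DK ν = conj b(∇_{1,ν})`, `LapK = conj b(Δ_1)`.  THIS FILE closes the gap on the cube
side exactly as r05's G-F6a does for the whole-torus letter: (a) `∇_{Ṽ,μ} − ∇_{1,μ} = F_μσ_μ` with `F_μ` a SITE-LOCAL multiplier of size `2α_T·(Lⁿη)⁻¹` at every row's own block
(F3's bond window ✓`hW1_cut` at the row's source, block distance `0`), so `∇_{Ṽ,μ}·G` inherits the (3.42)₂ shape from the transferred flat entry by [4]'s shift calculus; (b)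
`Δ_Ṽ − Δ_1 = Σ_μ[−F′_μ∇_{1,μ} + c_f(F′_μ − F_μ)σ_μ + B_μσ_{−μ}∇_{1,μ} + B_μF′_μ]` with the DIFFERENCE QUOTIENT of the multiplier of size `2α_T(Lⁿη)⁻²` (F3's variation
window ✓`hW2_cut` at the row's source); (c) the right entry `G·∇*_{Ṽ,ν} = G·∇*_{1,ν} + (G·B_ν)σ_{−ν}` reduced to its FLAT half (displayed: cell GAPS G-B9-02 — it needs the
right-oriented flat entries of `G_□(1)` and the mixed entry `∇G_□(1)∇*`, neither in the named fact's family ✓`GDirBFam` (`e 2 := 0`)).  The only change w.r.t. r05's proof: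
the multiplier sizes are fed POINTWISE (§1 `…_pt` variants of r05's `norm_mulOpB_apply_le` ∕ `norm_mulOpB_inv_apply_le` ∕ `norm_mulDiff_apply_le`), since the sharp cut's
windows hold at a row's own block scale and not uniformly on the torus.

WHAT IS PROVED (0 `def`s; theorems; 0 sorry; 0 new named facts; standard axioms): §1 `norm_mulOpB_apply_le_pt`, `norm_mulOpB_inv_apply_le_pt`, `norm_mulDiff_apply_le_pt`;
§2 ★★★`gDir_knit_entries_at_cutField` — under F4's hypothesis list VERBATIM (plus the extra size threshold folded into `a₁`): `IsUnit padΔ_{loc,□}(Ṽ)` ∧ `G ≺ B_f(Lⁿη)²e^{−δd}` ∧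
`∀ν conj b(cdBₗ Ṽ ν)·G ≺ B_f·Lⁿη·e^{−δd}` ∧ `∀ν conj b(cdsBₗ Ṽ ν)·G ≺ B_f·Lⁿη·e^{−δd}` ∧ `conj b(lapBₗ Ṽ)·G ≺ B_f·1·e^{−δd}` ∧ (∀ ν B₂ ρ′ ≦ δ) `G·conj b(cdsBₗ 1 ν) ≺ B₂·Lⁿη·e^{−ρ′d} ⟹
G·conj b(cdsBₗ Ṽ ν) ≺ (B₂+B_f)·Lⁿη·e^{−ρ′d}`.

HONEST SCOPE ∕ NOT CLAIMED.  Transcription of r05's ✓`cor36_G_cube_entries_at_locCfg'` (proof structure and [4]'s majorant calculus BY NAME); CONDITIONAL BY NAME on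
`B6.Prop26DirichletPrinted` (through F4); DISPLAYED: the socket `hKB`, the datum and numerics, the bi-contractivity `hU`, member thresholds; the RIGHT entry (3.42)₃ is proved
MODULO its flat half at `Ṽ` (cell GAPS G-B9-02, print p. 398 «conventional»; not derived here); constants unoptimised.  The member-level bundle is F6.  Nothing on `d = 4`,
the continuum, reflection positivity or the mass gap; NOT a node discharge; count-neutral; no row head changes.  NEW file; nothing landed is modified.  `--supports stmt-QuantumFields-27239`.

RELATED IN THE TREE, NOT DUPLICATED (searched 2026-08-31: `rg 'gDir_knit_entries_at_cutField|norm_mulOpB_apply_le_pt'` over `Literature/` + `Summits/` = ∅): r05 ✓`B9Cor36GCubeEntriesAtV`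
(the whole-torus twin; letters `shiftOpB`, `mulOpB`, identities `cdBₗ_eq_add` … USED BY NAME), F4 ✓`B9Cor36GDirKnitAtCutField`, F3 ✓`B9Cor36GDirCutWindows`.
-/

noncomputable section

namespace Literature.MathematicalPhysics.QuantumFieldTheory.Balaban1983to89.B9Cor36GDirKnitEntriesAtCutField

open Complex
open B6RandomWalk (HasMajorant hasMajorant_mono hasMajorant_add Ineq261 Triangle254 c1_nonneg)
open B9Thm34Ext (toB6)
open B9Ineq347 (ScaleTransfer)
open B9Eq39Adjoint (R R_add R_sub R_smul R_one covD covDstar)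
open B9Eq352DivFormLetters (conj conj_apply conj_sub conj_neg coordEquiv)
open B6KLevelCensusIndexV1 (KIdx kGeo)
open B6Cover236MultiLevelBlocks (cubes)
open B6GlobalChartV1 (PV boxEquiv)
open B6GlobalChartV1L0 (blkV1)
open B9BackgroundsKLevelV1 (shiftsV1)
open B9Eq360DeltaPrimeAY (AfldY)
open B9Eq360DeltaPrimeACubeY (blkCubeY)
open B9Eq337CutFieldDirY (cutCfgS)
open B9CubeLettersOpsL0 (cubeFamY levCubeY)
open B9CubeLettersBondOpsL0 (BlkCubeY)
open B9CubeGeometryInputs (geoCK geoCK_len geoCK_eta geoCK_eta_pos geoCK_len_pos geoCK_dist_axioms RM1 N1 exists_h261_geoCK hST_geoCK geoCK_site_nonempty)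
open B9CoReadingCoords (cdBₗ cdsBₗ lapBₗ cdBₗ_apply cdsBₗ_apply lapBₗ_apply)
open B9Cor35GpCubeInputsAtOne (coordEquiv_symm_eq_sum_liftY hasMajorant_conj_of_liftY hasMajorant_shift_mul_weighted hasMajorant_neg hasMajorant_smul)
open B9Cor35GCubeInputsAtOne (blkBK DK LapK kGeo_eta)
open B9Cor35CinvAtCubeLetters (kernel_rate_mono)
open B9Ineq373HessianPieceBoundsY (dSite dSite_shift_le dSite_self norm_R_sub_R_le norm_Rinv_sub_self_le)
open B9Cor36GCubeWindows (alphaW alphaW_nonneg)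
open B9Cor36GCubeAtLocCfg (alphaW_le_sixty_mul)
open B9Cor36SiteSandwichTransfer (hasMajorant_mul_of_rowLocal hasMajorant_mul_of_rowLocal_right rowLocal_conj_of_local)
open B9Cor36GpCubeEntriesAtV (hasMajorant_weighted_mul_shift hasMajorant_one_decay conj_add')
open B9Cor36GpCubeLocAtMember (hasMajorant_congr_op hasMajorant_finset_sum kernel_le)
open B9Cor35GpAtCubeLetters (hasMajorant_weaken)
open B9Cor36GCubeEntriesAtV (shiftOpB shiftOpB' mulOpB mulDefBF mulDefBF' mulDefBB mulOpB_apply cdBₗ_eq_add cdsBₗ_eq_add cdsBₗ_one_eq_neg cdsBₗ_mul_cdBₗ_eq conj_cdBₗ_one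
  conj_lapBₗ_one lapBₗ_eq_sum hasMajorant_conj_shiftOpB hasMajorant_conj_shiftOpB' abs_cf_mul_eta_mul conj_sum' conj_smul')
open B9Cor36GDirCutWindows (hW1_cut hW2_cut)
open B9Cor36GDirKnitAtCutField (gDir_knit_at_cutField gDir_knit_at_cutFieldU)
open B9Cor35GDirInputsAtOne (GiK mDirC geoDirBI domDirBI admDirBI GDirBFam)
open B9Cor35GDirKnitInputsAtOne (TKnitCY)
open B9Cor35GpDirInputsAtOne (dirDomY)
open B9DirichletBondCubePairY (padDeltaLocCY)
open B9Eq3115KnitCubeLetterY (QknitCubeY QsknitCubeY)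
open B9C2FormBoxRegimeY (Kpl)
open B7Prop5CplxLevels (epsCplx tauCplx)
open B7Prop2Explicit (C0 c2')
open B7Prop3Flat (c3)
open Node00 (SiteY CfgY FBondY toKT shiftY liftY liftY_apply liftEndY liftEndY_liftY cdB cdsB lapB cdB_one cdsB_one)
open Node00.OpsYNablaBridge (chartY shift_unshift unshift_shift)
open Node00.OpsYCubeProjectionG (DPDsDirCubeY)
open Node00.OpsYCubeDirInverseBond (bondsOverY)
open scoped Matrix Matrix.Norms.L2Operator

variable {d ℓ : ℕ} {hd : 1 ≤ d + 1} {hL : Odd (ℓ + 1) ∧ 1 < ℓ + 1} {b₀ b₁ : ℝ}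

/-! ## §1  The multiplier sizes, fed POINTWISE (the sharp cut's windows hold at a row's own block scale) -/

section Sizes

variable {𝔸 : Type} [NormedRing 𝔸] [NormedAlgebra ℂ 𝔸] [CompleteSpace 𝔸]
variable (i : KIdx d ℓ hd hL b₀ b₁)

omit [CompleteSpace 𝔸] in
/-- r05's ✓`norm_mulOpB_apply_le` with the window at the row's own source site only: `‖W(f₋) − 1‖ ≤ ω·η·t ⟹ ‖(mulOpB W X)(f)‖ ≤ 2ω·t·‖X(f)‖`.
[cite: Balaban1985BackgroundPropagators, (3.37) p.396, p.403 l.1–9] -/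
theorem norm_mulOpB_apply_le_pt {W : Site (PV d ℓ i.m i.K hd hL) 0 → 𝔸ˣ} (hW : ∀ x, ‖(W x : 𝔸)‖ ≤ 1 ∧ ‖(((W x)⁻¹ : 𝔸ˣ) : 𝔸)‖ ≤ 1) {ω t : ℝ} {f : FBondY i}
    (hWin : ‖(W f.src : 𝔸) - 1‖ ≤ ω * ((kGeo i).eta * t)) (X : FBondY i → 𝔸) :
    ‖mulOpB i W X f‖ ≤ 2 * ω * t * ‖X f‖ := by
  rw [mulOpB_apply, norm_smul, Complex.norm_real, Real.norm_eq_abs]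
  have h := B11Eq135Weitzenbock.norm_R_sub_self_le (hW f.src).2 (X f)
  calc |i.cf| * ‖R (W f.src) (X f) - X f‖ ≤ |i.cf| * (2 * ‖(W f.src : 𝔸) - 1‖ * ‖X f‖) := mul_le_mul_of_nonneg_left h (abs_nonneg _)
    _ ≤ |i.cf| * (2 * (ω * ((kGeo i).eta * t)) * ‖X f‖) := by gcongr
    _ = 2 * (|i.cf| * (ω * ((kGeo i).eta * t))) * ‖X f‖ := by ring
    _ = 2 * ω * t * ‖X f‖ := by rw [abs_cf_mul_eta_mul]; ring

omit [CompleteSpace 𝔸] in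
/-- the inverse-multiplier version, pointwise. [cite: Balaban1985BackgroundPropagators, (3.37) p.396, (3.8) p.392, p.403 l.1–9] -/
theorem norm_mulOpB_inv_apply_le_pt {W : Site (PV d ℓ i.m i.K hd hL) 0 → 𝔸ˣ} (hW : ∀ x, ‖(W x : 𝔸)‖ ≤ 1 ∧ ‖(((W x)⁻¹ : 𝔸ˣ) : 𝔸)‖ ≤ 1) {ω t : ℝ} {f : FBondY i}
    (hWin : ‖(W f.src : 𝔸) - 1‖ ≤ ω * ((kGeo i).eta * t)) (X : FBondY i → 𝔸) :
    ‖mulOpB i (fun x => (W x)⁻¹) X f‖ ≤ 2 * ω * t * ‖X f‖ := by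
  rw [mulOpB_apply, norm_smul, Complex.norm_real, Real.norm_eq_abs]
  have h := norm_Rinv_sub_self_le (hW f.src) (X f)
  calc |i.cf| * ‖R (W f.src)⁻¹ (X f) - X f‖ ≤ |i.cf| * (2 * ‖(W f.src : 𝔸) - 1‖ * ‖X f‖) := mul_le_mul_of_nonneg_left h (abs_nonneg _)
    _ ≤ |i.cf| * (2 * (ω * ((kGeo i).eta * t)) * ‖X f‖) := by gcongr
    _ = 2 * (|i.cf| * (ω * ((kGeo i).eta * t))) * ‖X f‖ := by ring
    _ = 2 * ω * t * ‖X f‖ := by rw [abs_cf_mul_eta_mul]; ring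

/-- the difference quotient of the multiplier, pointwise: `‖V_μ(f₋ − e_μ) − V_μ(f₋)‖ ≤ ω(ηt)² ⟹ ‖(c_f(F′_μ − F_μ)X)(f)‖ ≤ 2ω·t²·‖X(f)‖`.
[cite: Balaban1985BackgroundPropagators, (3.37) p.396 (the `∇A` condition), (3.73) p.405, (3.100) p.413] -/
theorem norm_mulDiff_apply_le_pt {V : CfgY 𝔸 i} (hU : ∀ μ x, ‖(V μ x : 𝔸)‖ ≤ 1 ∧ ‖(((V μ x)⁻¹ : 𝔸ˣ) : 𝔸)‖ ≤ 1) (μ : Fin (d + 1)) {ω t : ℝ} {f : FBondY i}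
    (hWin : ‖(V μ (f.src.unshift μ) : 𝔸) - V μ f.src‖ ≤ ω * ((kGeo i).eta * t) ^ 2) (X : FBondY i → 𝔸) :
    ‖((i.cf : ℝ) • (mulDefBF' i V μ - mulDefBF i V μ)) X f‖ ≤ 2 * ω * t ^ 2 * ‖X f‖ := by
  rw [LinearMap.smul_apply, Pi.smul_apply, LinearMap.sub_apply, Pi.sub_apply, mulOpB_apply, mulOpB_apply, ← smul_sub, norm_smul, norm_smul,
    Complex.norm_real, Real.norm_eq_abs]
  have e : R (V μ (f.src.unshift μ)) (X f) - X f - (R (V μ f.src) (X f) - X f) = R (V μ (f.src.unshift μ)) (X f) - R (V μ f.src) (X f) := by abel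
  rw [e]
  have h := norm_R_sub_R_le (hU μ (f.src.unshift μ)) (hU μ f.src) (X f)
  have hη : (kGeo i).eta ≠ 0 := (B9BackgroundsKLevelV1.eta_pos_L_one_le_M_pos i).1.ne'
  calc |i.cf| * (|i.cf| * ‖R (V μ (f.src.unshift μ)) (X f) - R (V μ f.src) (X f)‖)
      ≤ |i.cf| * (|i.cf| * (2 * ‖(V μ (f.src.unshift μ) : 𝔸) - V μ f.src‖ * ‖X f‖)) := by gcongr
    _ ≤ |i.cf| * (|i.cf| * (2 * (ω * ((kGeo i).eta * t) ^ 2) * ‖X f‖)) := by gcongr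
    _ = (((kGeo i).eta)⁻¹ * (kGeo i).eta) ^ 2 * (2 * ω * t ^ 2 * ‖X f‖) := by rw [B9Ineq373HessianPieceBoundsY.abs_cf_eq]; ring
    _ = 2 * ω * t ^ 2 * ‖X f‖ := by rw [inv_mul_cancel₀ hη, one_pow, one_mul]

end Sizes

/-! ## §2  ★★★ Corollary 3.6 at one cover cube: the (3.42) entries of `G_□(Ṽ)` WITH THE COVARIANT BOND DERIVATIVES AT `Ṽ`, over the cube sequence's blocks -/

section Main

variable {N : ℕ} [Nonempty (Fin N)]
variable {ι : Type} [Fintype ι] [DecidableEq ι] (b : Module.Basis ι ℝ (Matrix (Fin N) (Fin N) ℂ))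

set_option maxHeartbeats 4000000 in
/-- ★★★ **THE α₀-UNIFORM EDITION OF `gDir_knit_entries_at_cutField`** (dag-n06-d g35, LOCATED-37): the SAME covariant (3.42) entries of `G := conj b(G_□(Ṽ)♯ℝ)` at the
sharp-cut field, with the auxiliary knit-leg parameter `α₀` (`0 < α₀`, `0 ≤ Mα₀`, `K_pl(Mα₀)L⁴ < α₀′`) quantified INSIDE the universal block, so that the constants
`(δ, B_f, M₀, T₀, N₀, a₁)` are chosen before it (uniform in the member-dependent `α₀` the heads offer).  The proof is the original one with `α₀ hα₀` introduced
after the witnesses, over ✓`gDir_knit_at_cutFieldU`; `gDir_knit_entries_at_cutField` below is now its corollary.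
[cite: Balaban1985BackgroundPropagators, Cor. 3.6 p.408, Thm 3.1 (3.42) p.397, Thm 3.3 p.399, (3.86) p.407, p.410 l.14–15; Balaban1984PropagatorsII, (2.51) p.232, Lemma 2.1 (2.61) p.234] -/
theorem gDir_knit_entries_at_cutFieldU
    (h26 : B6.Prop26DirichletPrinted (geoDirBI (d := d) (ℓ := ℓ) (hd := hd) (hL := hL) (b₀ := b₀) (b₁ := b₁)) domDirBI admDirBI GDirBFam)
    (hℓ : 1 ≤ ℓ) (hb₀ : 0 < b₀) (hb₁ : b₀ ≤ b₁) (M₂ : ℝ) (hM₂ : 0 ≤ M₂) (hrepr : ∀ (v : Matrix (Fin N) (Fin N) ℂ) (j : ι), |b.repr v j| ≤ M₂ * ‖v‖)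
    {α₀' ϱ' ϱ : ℝ} (hα' : 0 < α₀') (hα3 : C0 (d + 1) * α₀' ≤ 1 / 3) (hα8 : 8 * α₀' ≤ c2' (d + 1) (ℓ + 1))
    (hϱ' : 0 < ϱ') (hϱ : 0 < ϱ)
    (hsmall' : Real.exp (4 * (800 * (((d + 1 : ℕ) : ℝ) + 1) ^ 2 * (((d + 1 : ℕ) : ℝ) + 4)) * α₀') * (1 + 8 * (131072 * (((d + 1 : ℕ) : ℝ) + 1) ^ 2) * ϱ') ≤ 2)
    (hc₃' : 2 * ϱ' ≤ c3 (d + 1) (ℓ + 1)) (hϱ'1 : 409600 * (((d + 1 : ℕ) : ℝ) + 1) ^ 2 * ϱ' ≤ 1)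
    (hE : epsCplx (d + 1) (ℓ + 1) ϱ' 0 ≤ 1 / 16)
    (hdX : ((d + 1 : ℕ) : ℝ) * (epsCplx (d + 1) (ℓ + 1) ϱ' 0 + tauCplx (d + 1) (ℓ + 1) α₀' 0 ϱ' 0) ≤ 1 / 16)
    (hsmallJ : Real.exp (4480 * (((d + 1 : ℕ) : ℝ) + 1) ^ 2 * (((d + 1 : ℕ) : ℝ) + 4) * α₀' + 240000 * (((d + 1 : ℕ) : ℝ) + 1) ^ 3 * ϱ') *
      (1 + 8 * (2097152 * (((d + 1 : ℕ) : ℝ) + 1) ^ 2) * ϱ) ≤ 2)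
    (hc₃J : 2 * ϱ ≤ c3 (d + 1) (ℓ + 1) / 4) :
    ∃ δ Bf M₀ T₀ : ℝ, ∃ N₀ : ℕ, 0 < δ ∧ 0 ≤ Bf ∧ ∃ a₁ : ℝ, 0 < a₁ ∧
    ∀ (i : KIdx d ℓ hd hL b₀ b₁) (c : ↥(cubes (toKT i).D.toDomains)) (Rr : ℝ) (H : Prop),
      M₀ ≤ ((ℓ : ℝ) + 1) * (toKT i).Mh → N₀ + 1 ≤ (toKT i).R * ((ℓ + 1) * (toKT i).Mh) → T₀ ≤ RM1 i →
    ∀ α₀ : ℝ, 0 < α₀ → 0 ≤ (kGeo i).M * α₀ → Kpl i ((kGeo i).M * α₀) * (kGeo i).L ^ 4 < α₀' →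
    ∀ (KB : Matrix (FBondY i) (FBondY i) ℝ),
      (mDirC i c).submatrix (fun v : ↥(bondsOverY i (dirDomY i c)) => (v : FBondY i)) (fun v : ↥(bondsOverY i (dirDomY i c)) => (v : FBondY i)) *
        KB.submatrix (fun v : ↥(bondsOverY i (dirDomY i c)) => (v : FBondY i)) (fun v : ↥(bondsOverY i (dirDomY i c)) => (v : FBondY i)) = 1 →
    ∀ (T : Finset (SiteY i)) (A : AfldY (Matrix (Fin N) (Fin N) ℂ) i) (Q : Set (Site (PV d ℓ i.m i.K hd hL) 0)) (C ξ Λ : ℝ),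
      0 ≤ C → (kGeo i).eta ≤ ξ → 1 ≤ Λ → LatticeNorms.scaleLen ((ℓ : ℝ) + 1) (kGeo i).eta (c.1.1 + 1) ≤ Λ * ξ →
      (∀ z ∈ dirDomY i c, z ∈ T) → (∀ z ∈ T, (boxEquiv i.hN).symm z ∈ Q) →
      (∀ κ, ∀ x ∈ Q, ‖A κ x‖ ≤ C * ξ⁻¹) →
      (∀ μ ν, ∀ x ∈ Q, ‖(((kGeo i).eta : ℂ)⁻¹) • covD (shiftsV1 (PV d ℓ i.m i.K hd hL)) (fun _ _ => (1 : (Matrix (Fin N) (Fin N) ℂ)ˣ)) μ (A ν) x‖ ≤ C * (ξ ^ 2)⁻¹) →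
      (∀ z : SiteY i, 1 ≤ levCubeY i c z → z ∈ dirDomY i c ∧ ∀ μ, shiftY i μ z ∈ dirDomY i c ∧ (shiftY i μ).symm z ∈ dirDomY i c ∧
        ∀ ν, shiftY i ν (shiftY i μ z) ∈ dirDomY i c ∧ shiftY i ν ((shiftY i μ).symm z) ∈ dirDomY i c ∧ (shiftY i ν).symm ((shiftY i μ).symm z) ∈ dirDomY i c) →
      2 * C * Λ ^ 2 ≤ a₁ → 3 * (2 * C * Λ ^ 2) ≤ ϱ' →
      4 * α₀' ≤ c2' (d + 1) (ℓ + 1) →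
      Real.exp (4 * (800 * (((d + 1 : ℕ) : ℝ) + 1) ^ 2 * (((d + 1 : ℕ) : ℝ) + 4)) * α₀') * (1 + 8 * (131072 * (((d + 1 : ℕ) : ℝ) + 1) ^ 2) * (2 * C * Λ ^ 2)) ≤ 2 →
      2 * (2 * C * Λ ^ 2) ≤ c3 (d + 1) (ℓ + 1) → 4096 * ((d + 1 : ℕ) : ℝ) * (2 * C * Λ ^ 2) ≤ 1 →
      (∀ μ x, ‖(cutCfgS i T (kGeo i).eta A μ x : Matrix (Fin N) (Fin N) ℂ)‖ ≤ 1 ∧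
        ‖(((cutCfgS i T (kGeo i).eta A μ x)⁻¹ : (Matrix (Fin N) (Fin N) ℂ)ˣ) : Matrix (Fin N) (Fin N) ℂ)‖ ≤ 1) →
      IsUnit (padDeltaLocCY i c (QknitCubeY i c) (QsknitCubeY i c) (DPDsDirCubeY i c (dirDomY i c)) (bondsOverY i (dirDomY i c)) (cutCfgS i T (kGeo i).eta A)) ∧
      HasMajorant (g := toB6 (geoCK i c) Rr H) (blkBK i c) (GiK b i (TKnitCY i c (cutCfgS i T (kGeo i).eta A)) (bondsOverY i (dirDomY i c)))
        (fun a a' => Bf * (geoCK i c).len a ^ 2 * Real.exp (-(δ * (geoCK i c).dist a a'))) ∧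
      (∀ ν : Fin (d + 1), HasMajorant (g := toB6 (geoCK i c) Rr H) (blkBK i c)
        (conj b (cdBₗ i (cutCfgS i T (kGeo i).eta A) ν) * GiK b i (TKnitCY i c (cutCfgS i T (kGeo i).eta A)) (bondsOverY i (dirDomY i c)))
        (fun a a' => Bf * (geoCK i c).len a * Real.exp (-(δ * (geoCK i c).dist a a')))) ∧
      (∀ ν : Fin (d + 1), HasMajorant (g := toB6 (geoCK i c) Rr H) (blkBK i c)
        (conj b (cdsBₗ i (cutCfgS i T (kGeo i).eta A) ν) * GiK b i (TKnitCY i c (cutCfgS i T (kGeo i).eta A)) (bondsOverY i (dirDomY i c)))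
        (fun a a' => Bf * (geoCK i c).len a * Real.exp (-(δ * (geoCK i c).dist a a')))) ∧
      HasMajorant (g := toB6 (geoCK i c) Rr H) (blkBK i c)
        (conj b (lapBₗ i (cutCfgS i T (kGeo i).eta A)) * GiK b i (TKnitCY i c (cutCfgS i T (kGeo i).eta A)) (bondsOverY i (dirDomY i c)))
        (fun a a' => Bf * 1 * Real.exp (-(δ * (geoCK i c).dist a a'))) ∧
      (∀ (ν : Fin (d + 1)) (B₂ ρ' : ℝ), 0 ≤ B₂ → 0 ≤ ρ' → ρ' ≤ δ →
        HasMajorant (g := toB6 (geoCK i c) Rr H) (blkBK i c)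
          (GiK b i (TKnitCY i c (cutCfgS i T (kGeo i).eta A)) (bondsOverY i (dirDomY i c)) * conj b (cdsBₗ i (fun _ _ => (1 : (Matrix (Fin N) (Fin N) ℂ)ˣ)) ν))
          (fun a a' => B₂ * (geoCK i c).len a * Real.exp (-(ρ' * (geoCK i c).dist a a'))) →
        HasMajorant (g := toB6 (geoCK i c) Rr H) (blkBK i c)
          (GiK b i (TKnitCY i c (cutCfgS i T (kGeo i).eta A)) (bondsOverY i (dirDomY i c)) * conj b (cdsBₗ i (cutCfgS i T (kGeo i).eta A) ν))
          (fun a a' => (B₂ + Bf) * (geoCK i c).len a * Real.exp (-(ρ' * (geoCK i c).dist a a')))) := by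
  classical
  have hSb : 0 ≤ M₂ * ∑ j, ‖b j‖ := mul_nonneg hM₂ (Finset.sum_nonneg fun j _ => norm_nonneg _)
  obtain ⟨ρ, θ, M₀, T₀, N₀, hρ, hθ, a₁, ha₁, AG, hAG, h⟩ := gDir_knit_at_cutFieldU b h26 hℓ hb₀ hb₁ M₂ hM₂ hrepr hα' hα3 hα8 hϱ' hϱ hsmall' hc₃' hϱ'1 hE hdX
    hsmallJ hc₃J
  -- the rates: transferred entries at `ρ₁ = (1 − κ)ρ`; shift corrections at `δ_f = (1 − κ)²ρ₁`, `κ = 9∕5000`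
  have hρ₁ : 0 < (1 - 9 / 5000) * ρ := by positivity
  obtain ⟨dB, h261⟩ := exists_h261_geoCK d ℓ (δ₀ := (1 - 9 / 5000) * ((1 - 9 / 5000) * ρ)) (by positivity)
  -- the constants
  set Sb : ℝ := M₂ * ∑ j, ‖b j‖ with hSbdef
  set A₁ : ℝ := AG * θ with hA₁def
  set Λ4 : ℝ := ((ℓ : ℝ) + 1) ^ 4 with hΛ4def
  have hA₁ : 0 ≤ A₁ := mul_nonneg hAG.le hθ
  have hΛ4 : 0 ≤ Λ4 := by positivity
  have hBf : 0 ≤ A₁ + Real.exp ((1 - 9 / 5000) * ρ) * A₁ * Λ4 * B6.c1 dB ((1 - 9 / 5000) * ((1 - 9 / 5000) * ρ)) (9 / 5000) ^ 2 +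
      2 * Sb * Real.exp ((1 - 9 / 5000) * ρ) * A₁ * Λ4 * B6.c1 dB ((1 - 9 / 5000) * ((1 - 9 / 5000) * ρ)) (9 / 5000) ^ 2 +
      ((d : ℝ) + 1) * (2 * Sb * A₁ + 2 * (2 * Sb * Real.exp ((1 - 9 / 5000) * ρ) * A₁ * Λ4 * B6.c1 dB ((1 - 9 / 5000) * ((1 - 9 / 5000) * ρ)) (9 / 5000) ^ 2) +
        4 * Sb ^ 2 * A₁) := by positivity
  refine ⟨(1 - 9 / 5000) * ((1 - 9 / 5000) * ((1 - 9 / 5000) * ρ)), _, M₀, max T₀ (max (4 * Real.log ((ℓ : ℝ) + 1) / (9 / 5000 * ((1 - 9 / 5000) * ρ))) 3),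
    max N₀ (N1 d ℓ (9 / 5000 * ((1 - 9 / 5000) * ((1 - 9 / 5000) * ρ)))), by positivity, hBf, min a₁ (1 / (120 * ((ℓ : ℝ) + 1) ^ 2)),
    lt_min ha₁ (by positivity), ?_⟩
  intro i c Rr H hM hN hT α₀ hα₀ hMα hKpl KB hKB T A Q C ξ Λ hC hξ hΛ hΛξ hTS hQT hA hdA hS2 hsa hα₁ϱ hα4' hsmall hc₃ hsm hU
  have hN₀ : N₀ + 1 ≤ (toKT i).R * ((ℓ + 1) * (toKT i).Mh) := le_trans (Nat.succ_le_succ (le_max_left _ _)) hN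
  have hN₁ : N1 d ℓ (9 / 5000 * ((1 - 9 / 5000) * ((1 - 9 / 5000) * ρ))) + 1 ≤ (toKT i).R * ((ℓ + 1) * (toKT i).Mh) :=
    le_trans (Nat.succ_le_succ (le_max_right _ _)) hN
  have hT₀ : T₀ ≤ RM1 i := (le_max_left _ _).trans hT
  have hT₁ : 4 * Real.log ((ℓ : ℝ) + 1) / (9 / 5000 * ((1 - 9 / 5000) * ρ)) ≤ RM1 i := ((le_max_left _ _).trans (le_max_right _ _)).trans hT
  have hRM : 2 < RM1 i := lt_of_lt_of_le (by norm_num) (((le_max_right _ _).trans (le_max_right _ _)).trans hT)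
  have hsa₁ : 2 * C * Λ ^ 2 ≤ a₁ := hsa.trans (min_le_left _ _)
  have hs120 : 2 * C * Λ ^ 2 ≤ 1 / (120 * ((ℓ : ℝ) + 1) ^ 2) := hsa.trans (min_le_right _ _)
  obtain ⟨hunit, -, -, -, e0, e1, e3⟩ := h i c Rr H hM hN₀ hT₀ α₀ hα₀ hMα hKpl KB hKB T A Q C ξ Λ hC hξ hΛ hΛξ hTS hQT hA hdA hS2 hsa₁ hα₁ϱ hα4' hsmall hc₃ hsm hU
  -- abbreviations
  set ρ₁ : ℝ := (1 - 9 / 5000) * ρ with hρ₁def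
  set c1 : ℝ := B6.c1 dB ((1 - 9 / 5000) * ρ₁) (9 / 5000) with hc1def
  set K₀ : ℝ := Real.exp ρ₁ * A₁ * Λ4 * c1 ^ 2 with hK₀def
  set K₁ : ℝ := 2 * Sb * Real.exp ρ₁ * A₁ * Λ4 * c1 ^ 2 with hK₁def
  set Bf : ℝ := A₁ + K₀ + K₁ + ((d : ℝ) + 1) * (2 * Sb * A₁ + 2 * K₁ + 4 * Sb ^ 2 * A₁) with hBfdef
  have hc1 : 0 ≤ c1 := c1_nonneg _ _ _
  have hK₀ : 0 ≤ K₀ := by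
    rw [hK₀def]; exact mul_nonneg (mul_nonneg (mul_nonneg (Real.exp_nonneg _) hA₁) hΛ4) (sq_nonneg _)
  have hK₁ : 0 ≤ K₁ := by
    rw [hK₁def]; exact mul_nonneg (mul_nonneg (mul_nonneg (mul_nonneg (mul_nonneg (by norm_num) hSb) (Real.exp_nonneg _)) hA₁) hΛ4) (sq_nonneg _)
  have hBf' : 0 ≤ Bf := by
    have h1 := mul_nonneg hSb hA₁; have h2 := mul_nonneg (sq_nonneg Sb) hA₁
    have h3 : 0 ≤ ((d : ℝ) + 1) * (2 * Sb * A₁ + 2 * K₁ + 4 * Sb ^ 2 * A₁) := mul_nonneg (by positivity) (by linarith)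
    rw [hBfdef]; linarith
  set δf : ℝ := (1 - 9 / 5000) * ((1 - 9 / 5000) * ρ₁) with hδfdef
  have hδf : 0 < δf := by rw [hδfdef]; positivity
  have hδfρ₁ : δf ≤ ρ₁ := by rw [hδfdef]; nlinarith
  set η : ℝ := (kGeo i).eta with hηdef
  have hη : 0 < η := (B9BackgroundsKLevelV1.eta_pos_L_one_le_M_pos i).1
  set V := cutCfgS i T η A with hVdef
  set G := GiK b i (TKnitCY i c V) (bondsOverY i (dirDomY i c)) with hGdef
  haveI : Nonempty (geoCK i c).Site := geoCK_site_nonempty i c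
  obtain ⟨hdnn, htri, hrefl, -⟩ := geoCK_dist_axioms i c Rr H
  have hlen0 : ∀ a : BlkCubeY i c, 0 ≤ (geoCK i c).len a := fun a => (geoCK_len_pos i c a).le
  have hlen2 : ∀ a : BlkCubeY i c, 0 ≤ (geoCK i c).len a ^ 2 := fun a => sq_nonneg _
  -- the window constant `α_T = alphaW(2CΛ²)·L² ≤ 1`
  set αW : ℝ := alphaW (2 * C * Λ ^ 2) * ((ℓ : ℝ) + 1) ^ 2 with hαWdef
  have hα₁0 : 0 ≤ 2 * C * Λ ^ 2 := by positivity
  have hαW0 : 0 ≤ αW := by rw [hαWdef]; exact mul_nonneg (alphaW_nonneg hα₁0) (sq_nonneg _)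
  have hαW1 : αW ≤ 1 := by
    have hL21 : (1 : ℝ) ≤ ((ℓ : ℝ) + 1) ^ 2 := one_le_pow₀ (by linarith [(Nat.cast_nonneg ℓ : (0 : ℝ) ≤ ℓ)])
    have h16 : 2 * C * Λ ^ 2 ≤ 1 / 6 := hs120.trans (one_div_le_one_div_of_le (by norm_num) (by nlinarith [hL21]))
    have h60 := alphaW_le_sixty_mul hα₁0 h16
    have hL20 : 0 < ((ℓ : ℝ) + 1) ^ 2 := by positivity
    have h1 : alphaW (2 * C * Λ ^ 2) * ((ℓ : ℝ) + 1) ^ 2 ≤ 60 * (2 * C * Λ ^ 2) * ((ℓ : ℝ) + 1) ^ 2 := mul_le_mul_of_nonneg_right h60 hL20.le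
    have h2 : 60 * (2 * C * Λ ^ 2) * ((ℓ : ℝ) + 1) ^ 2 ≤ 60 * (1 / (120 * ((ℓ : ℝ) + 1) ^ 2)) * ((ℓ : ℝ) + 1) ^ 2 := by gcongr
    have h3 : 60 * (1 / (120 * ((ℓ : ℝ) + 1) ^ 2)) * ((ℓ : ℝ) + 1) ^ 2 = 1 / 2 := by field_simp; ring
    rw [hαWdef]; linarith
  -- the windows of the sharp cut at a block and a point within block distance 2 (F3)
  have hS2T : ∀ z : SiteY i, 1 ≤ levCubeY i c z → z ∈ T ∧ ∀ μ, shiftY i μ z ∈ T ∧ (shiftY i μ).symm z ∈ T ∧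
      ∀ ν, shiftY i ν (shiftY i μ z) ∈ T ∧ shiftY i ν ((shiftY i μ).symm z) ∈ T ∧ (shiftY i ν).symm ((shiftY i μ).symm z) ∈ T := fun z hz => by
    obtain ⟨h0, hμ⟩ := hS2 z hz
    exact ⟨hTS _ h0, fun μ => ⟨hTS _ (hμ μ).1, hTS _ (hμ μ).2.1, fun ν =>
      ⟨hTS _ ((hμ μ).2.2 ν).1, hTS _ ((hμ μ).2.2 ν).2.1, hTS _ ((hμ μ).2.2 ν).2.2⟩⟩⟩
  have hW1 : ∀ (a : BlkCubeY i c) (κ : Fin (d + 1)) (y : Site (PV d ℓ i.m i.K hd hL) 0), dSite i c a y ≤ 2 →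
      ‖(V κ y : Matrix (Fin N) (Fin N) ℂ) - 1‖ ≤ αW * (η * ((geoCK i c).len a)⁻¹) := fun a κ y hy => by
    rw [hVdef, hαWdef]; exact hW1_cut i c hC hξ hΛ hΛξ hQT hA hdA hS2T hRM a κ y hy
  have hW2 : ∀ (a : BlkCubeY i c) (κ μ : Fin (d + 1)) (y : Site (PV d ℓ i.m i.K hd hL) 0), dSite i c a y ≤ 2 →
      ‖(V κ (y.unshift μ) : Matrix (Fin N) (Fin N) ℂ) - V κ y‖ ≤ αW * (η * ((geoCK i c).len a)⁻¹) ^ 2 := fun a κ μ y hy => by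
    rw [norm_sub_rev, hVdef, hαWdef]; exact hW2_cut i c hC hξ hΛ hΛξ hQT hA hdA hS2T hRM a κ μ y hy
  -- the windows AT A ROW's OWN BLOCK: the source site and its backward neighbour are within block distance `1`
  have hd0 : ∀ f : FBondY i, dSite i c (blkV1 i.hN (cubeFamY i c) f) f.src ≤ 2 := fun f => by
    show dSite i c (blkCubeY i c (chartY i f.src)) f.src ≤ 2; rw [dSite_self]; norm_num
  have hd1 : ∀ (f : FBondY i) (μ : Fin (d + 1)), dSite i c (blkV1 i.hN (cubeFamY i c) f) (f.src.unshift μ) ≤ 2 := fun f μ => by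
    show dSite i c (blkCubeY i c (chartY i f.src)) (f.src.unshift μ) ≤ 2
    have h := (dSite_shift_le i c (blkCubeY i c (chartY i f.src)) f.src μ).2
    rw [dSite_self] at h; linarith
  -- ROW-LOCALITY of the multipliers (coefficient `2α_W·len(a)⁻¹·(M₂Σ‖b‖) ≤ 2·Sb·len(a)⁻¹`) and of the difference quotient (`2·Sb·(len(a)²)⁻¹`)
  have hcF : ∀ a : BlkCubeY i c, 0 ≤ 2 * ((geoCK i c).len a)⁻¹ * Sb := fun a => mul_nonneg (mul_nonneg (by norm_num) (inv_nonneg.2 (hlen0 a))) hSb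
  have hloc_of : ∀ (T : Module.End ℝ (FBondY i → Matrix (Fin N) (Fin N) ℂ)) (t : BlkCubeY i c → ℝ), (∀ a, 0 ≤ t a) →
      (∀ (X : FBondY i → Matrix (Fin N) (Fin N) ℂ) (f : FBondY i), ‖T X f‖ ≤ 2 * αW * t (blkV1 i.hN (cubeFamY i c) f) * ‖X f‖) →
      ∀ (w : FBondY i × ι → ℝ) (p : FBondY i × ι) (M : ℝ), (∀ p' : FBondY i × ι, blkBK i c p' = blkBK i c p → |w p'| ≤ M) →
        |conj b T w p| ≤ 2 * t (blkBK i c p) * Sb * M := by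
    intro T t ht hT w p M hw
    have h := rowLocal_conj_of_local b (fun f : FBondY i => blkV1 i.hN (cubeFamY i c) f) (fun a => 2 * t a) hM₂ hrepr T
      (fun X f Bf' hBf' => (hT X f).trans (by
        have hXf : ‖X f‖ ≤ Bf' := hBf' f rfl
        have h2t : 0 ≤ 2 * t (blkV1 i.hN (cubeFamY i c) f) := mul_nonneg (by norm_num) (ht _)
        calc 2 * αW * t (blkV1 i.hN (cubeFamY i c) f) * ‖X f‖ = αW * (2 * t (blkV1 i.hN (cubeFamY i c) f) * ‖X f‖) := by ring
          _ ≤ 1 * (2 * t (blkV1 i.hN (cubeFamY i c) f) * ‖X f‖) := mul_le_mul_of_nonneg_right hαW1 (mul_nonneg h2t (norm_nonneg _))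
          _ ≤ 1 * (2 * t (blkV1 i.hN (cubeFamY i c) f) * Bf') := by rw [one_mul, one_mul]; exact mul_le_mul_of_nonneg_left hXf h2t
          _ = 2 * t (blkV1 i.hN (cubeFamY i c) f) * Bf' := one_mul _)) w p M hw
    calc |conj b T w p| ≤ 2 * t (blkV1 i.hN (cubeFamY i c) p.1) * (M₂ * ∑ j, ‖b j‖) * M := h
      _ = 2 * t (blkBK i c p) * Sb * M := by rw [hSbdef]
  have hlocF : ∀ μ, ∀ (w : FBondY i × ι → ℝ) (p : FBondY i × ι) (M : ℝ), (∀ p' : FBondY i × ι, blkBK i c p' = blkBK i c p → |w p'| ≤ M) →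
      |conj b (mulDefBF i V μ) w p| ≤ 2 * ((geoCK i c).len (blkBK i c p))⁻¹ * Sb * M := fun μ =>
    hloc_of _ (fun a => ((geoCK i c).len a)⁻¹) (fun a => inv_nonneg.2 (hlen0 a)) fun X f =>
      norm_mulOpB_apply_le_pt i (W := V μ) (fun x => hU μ x) (hW1 _ μ _ (hd0 f)) X
  have hlocF' : ∀ μ, ∀ (w : FBondY i × ι → ℝ) (p : FBondY i × ι) (M : ℝ), (∀ p' : FBondY i × ι, blkBK i c p' = blkBK i c p → |w p'| ≤ M) →
      |conj b (mulDefBF' i V μ) w p| ≤ 2 * ((geoCK i c).len (blkBK i c p))⁻¹ * Sb * M := fun μ =>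
    hloc_of _ (fun a => ((geoCK i c).len a)⁻¹) (fun a => inv_nonneg.2 (hlen0 a)) fun X f =>
      norm_mulOpB_apply_le_pt i (W := fun x => V μ (x.unshift μ)) (fun x => hU μ _) (hW1 _ μ _ (hd1 f μ)) X
  have hlocB : ∀ μ, ∀ (w : FBondY i × ι → ℝ) (p : FBondY i × ι) (M : ℝ), (∀ p' : FBondY i × ι, blkBK i c p' = blkBK i c p → |w p'| ≤ M) →
      |conj b (mulDefBB i V μ) w p| ≤ 2 * ((geoCK i c).len (blkBK i c p))⁻¹ * Sb * M := fun μ =>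
    hloc_of _ (fun a => ((geoCK i c).len a)⁻¹) (fun a => inv_nonneg.2 (hlen0 a)) fun X f =>
      norm_mulOpB_inv_apply_le_pt i (W := fun x => V μ (x.unshift μ)) (fun x => hU μ _) (hW1 _ μ _ (hd1 f μ)) X
  have hlocE : ∀ μ, ∀ (w : FBondY i × ι → ℝ) (p : FBondY i × ι) (M : ℝ), (∀ p' : FBondY i × ι, blkBK i c p' = blkBK i c p → |w p'| ≤ M) →
      |conj b ((i.cf : ℝ) • (mulDefBF' i V μ - mulDefBF i V μ)) w p| ≤ 2 * ((geoCK i c).len (blkBK i c p) ^ 2)⁻¹ * Sb * M := fun μ =>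
    hloc_of _ (fun a => ((geoCK i c).len a ^ 2)⁻¹) (fun a => inv_nonneg.2 (hlen2 a)) fun X f => by
      have h := norm_mulDiff_apply_le_pt i hU μ (hW2 (blkV1 i.hN (cubeFamY i c) f) μ μ f.src (hd0 f)) X
      rw [inv_pow] at h
      exact h
  -- [4] Lemma 2.1 at `((1−κ)ρ₁, κ)`; the scale transfers at `(ρ₁, κ)`
  have h261' : Ineq261 dB (toB6 (geoCK i c) Rr H) ((1 - 9 / 5000) * ρ₁) (9 / 5000) := h261 i c Rr H hN₁ (9 / 5000) le_rfl (by norm_num)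
  obtain ⟨hST1, hST2, hST3, -, -, -⟩ := hST_geoCK i c hρ₁ hT₁ (9 / 5000) le_rfl
  have hPΛ1 : ∀ a e : BlkCubeY i c, Real.exp (-(9 / 5000 * ρ₁ * (geoCK i c).dist a e)) * (geoCK i c).len e ≤ Λ4 * (geoCK i c).len a := fun a e => hST1 a e
  have hPΛ2 : ∀ a e : BlkCubeY i c, Real.exp (-(9 / 5000 * ρ₁ * (geoCK i c).dist a e)) * (geoCK i c).len e ^ 2 ≤ Λ4 * (geoCK i c).len a ^ 2 := fun a e => hST2 a e
  have hPΛ3 : ∀ a e : BlkCubeY i c, Real.exp (-(9 / 5000 * ρ₁ * (geoCK i c).dist a e)) * ((geoCK i c).len e)⁻¹ ≤ Λ4 * ((geoCK i c).len a)⁻¹ := fun a e => hST3 a e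
  have hκρ : 0 ≤ 9 / 5000 * ρ₁ := by positivity
  have hκρ' : 0 ≤ (1 - 9 / 5000) * ρ₁ := by positivity
  -- the translations
  have hσ : ∀ μ, HasMajorant (g := toB6 (geoCK i c) Rr H) (blkBK i c) (conj b ((shiftOpB (𝔸 := Matrix (Fin N) (Fin N) ℂ) i μ).restrictScalars ℝ))
      (fun a a' => Real.exp ρ₁ * Real.exp (-(ρ₁ * (geoCK i c).dist a a'))) := fun μ => hasMajorant_conj_shiftOpB i c b Rr H hρ₁.le μ
  have hσ' : ∀ μ, HasMajorant (g := toB6 (geoCK i c) Rr H) (blkBK i c) (conj b ((shiftOpB' (𝔸 := Matrix (Fin N) (Fin N) ℂ) i μ).restrictScalars ℝ))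
      (fun a a' => Real.exp ρ₁ * Real.exp (-(ρ₁ * (geoCK i c).dist a a'))) := fun μ => hasMajorant_conj_shiftOpB' i c b Rr H hρ₁.le μ
  -- the transferred flat entries of G-F7 v1.1
  have E0 : HasMajorant (g := toB6 (geoCK i c) Rr H) (blkBK i c) G (fun a a' => A₁ * (geoCK i c).len a ^ 2 * Real.exp (-(ρ₁ * (geoCK i c).dist a a'))) := by
    rw [hA₁def]; exact e0
  have E1 : ∀ ν, HasMajorant (g := toB6 (geoCK i c) Rr H) (blkBK i c) (DK b i ν * G) (fun a a' => A₁ * (geoCK i c).len a * Real.exp (-(ρ₁ * (geoCK i c).dist a a'))) := by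
    rw [hA₁def]; exact e1
  have E3 : HasMajorant (g := toB6 (geoCK i c) Rr H) (blkBK i c) (LapK b i * G) (fun a a' => A₁ * 1 * Real.exp (-(ρ₁ * (geoCK i c).dist a a'))) := by
    rw [hA₁def]; exact e3
  -- SHIFTED ENTRIES: `σ_μ·G ≺ e^{ρ₁}A₁Λ4c₁²·len²·e^{−δ_f d}`, `σ_{−μ}·∇_μG ≺ e^{ρ₁}A₁Λ4c₁²·len·e^{−δ_f d}`
  have hσG : ∀ μ, HasMajorant (g := toB6 (geoCK i c) Rr H) (blkBK i c) (conj b ((shiftOpB (𝔸 := Matrix (Fin N) (Fin N) ℂ) i μ).restrictScalars ℝ) * G)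
      (fun a a' => Real.exp ρ₁ * A₁ * Λ4 * c1 ^ 2 * (geoCK i c).len a ^ 2 * Real.exp (-(δf * (geoCK i c).dist a a'))) := fun μ =>
    hasMajorant_shift_mul_weighted i c Rr H (blkBK i c) dB (fun a => (geoCK i c).len a ^ 2) (Real.exp_nonneg _) hA₁ hΛ4 hlen2 hκρ hκρ' (by norm_num) htri
      hPΛ2 h261' (hσ μ) E0
  have hσ'DG : ∀ μ, HasMajorant (g := toB6 (geoCK i c) Rr H) (blkBK i c) (conj b ((shiftOpB' (𝔸 := Matrix (Fin N) (Fin N) ℂ) i μ).restrictScalars ℝ) * (DK b i μ * G))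
      (fun a a' => Real.exp ρ₁ * A₁ * Λ4 * c1 ^ 2 * (geoCK i c).len a * Real.exp (-(δf * (geoCK i c).dist a a'))) := fun μ =>
    hasMajorant_shift_mul_weighted i c Rr H (blkBK i c) dB (fun a => (geoCK i c).len a) (Real.exp_nonneg _) hA₁ hΛ4 hlen0 hκρ hκρ' (by norm_num) htri
      hPΛ1 h261' (hσ' μ) (E1 μ)
  have hσ'G : ∀ μ, HasMajorant (g := toB6 (geoCK i c) Rr H) (blkBK i c) (conj b ((shiftOpB' (𝔸 := Matrix (Fin N) (Fin N) ℂ) i μ).restrictScalars ℝ) * G)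
      (fun a a' => Real.exp ρ₁ * A₁ * Λ4 * c1 ^ 2 * (geoCK i c).len a ^ 2 * Real.exp (-(δf * (geoCK i c).dist a a'))) := fun μ =>
    hasMajorant_shift_mul_weighted i c Rr H (blkBK i c) dB (fun a => (geoCK i c).len a ^ 2) (Real.exp_nonneg _) hA₁ hΛ4 hlen2 hκρ hκρ' (by norm_num) htri
      hPΛ2 h261' (hσ' μ) E0
  -- algebra of the weights
  have hlinv : ∀ a : BlkCubeY i c, ((geoCK i c).len a)⁻¹ * (geoCK i c).len a ^ 2 = (geoCK i c).len a := fun a => by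
    have := (geoCK_len_pos i c a).ne'; field_simp
  have hlinv1 : ∀ a : BlkCubeY i c, ((geoCK i c).len a)⁻¹ * (geoCK i c).len a = 1 := fun a => inv_mul_cancel₀ (geoCK_len_pos i c a).ne'
  have hlinv2 : ∀ a : BlkCubeY i c, ((geoCK i c).len a ^ 2)⁻¹ * (geoCK i c).len a ^ 2 = 1 := fun a => inv_mul_cancel₀ (pow_ne_zero 2 (geoCK_len_pos i c a).ne')
  have hexp0 : ∀ a a' : BlkCubeY i c, 0 ≤ Real.exp (-(δf * (geoCK i c).dist a a')) := fun a a' => Real.exp_nonneg _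
  -- ENTRY 1, correction: `F_μ·σ_μ·G ≺ K₁·len·e^{−δ_f d}`
  have hT1b : ∀ μ, HasMajorant (g := toB6 (geoCK i c) Rr H) (blkBK i c) (conj b (mulDefBF i V μ) * (conj b ((shiftOpB (𝔸 := Matrix (Fin N) (Fin N) ℂ) i μ).restrictScalars ℝ) * G))
      (fun a a' => K₁ * (geoCK i c).len a * Real.exp (-(δf * (geoCK i c).dist a a'))) := fun μ => by
    refine hasMajorant_mono (g := toB6 (geoCK i c) Rr H) _ (hasMajorant_mul_of_rowLocal (g := toB6 (geoCK i c) Rr H) (blkBK i c)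
      (fun a => 2 * ((geoCK i c).len a)⁻¹ * Sb) (hlocF μ) (hσG μ)) fun a a' => le_of_eq ?_
    calc 2 * ((geoCK i c).len a)⁻¹ * Sb * (Real.exp ρ₁ * A₁ * Λ4 * c1 ^ 2 * (geoCK i c).len a ^ 2 * Real.exp (-(δf * (geoCK i c).dist a a')))
        = 2 * Sb * Real.exp ρ₁ * A₁ * Λ4 * c1 ^ 2 * (((geoCK i c).len a)⁻¹ * (geoCK i c).len a ^ 2) * Real.exp (-(δf * (geoCK i c).dist a a')) := by ring
      _ = K₁ * (geoCK i c).len a * Real.exp (-(δf * (geoCK i c).dist a a')) := by rw [hlinv, hK₁def]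
  -- ENTRY 1 assembled
  have hEntry1 : ∀ ν, HasMajorant (g := toB6 (geoCK i c) Rr H) (blkBK i c) (conj b (cdBₗ i V ν) * G)
      (fun a a' => (A₁ + K₁) * (geoCK i c).len a * Real.exp (-(δf * (geoCK i c).dist a a'))) := fun ν => by
    have e : conj b (cdBₗ i V ν) * G = DK b i ν * G + conj b (mulDefBF i V ν) * (conj b ((shiftOpB (𝔸 := Matrix (Fin N) (Fin N) ℂ) i ν).restrictScalars ℝ) * G) := by
      rw [cdBₗ_eq_add, conj_add', B9Eq352DivFormLetters.conj_mul, conj_cdBₗ_one, add_mul, mul_assoc]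
    rw [e]
    refine hasMajorant_mono (g := toB6 (geoCK i c) Rr H) _ (hasMajorant_add (g := toB6 (geoCK i c) Rr H) _
      (hasMajorant_weaken i c Rr H _ hlen0 le_rfl hA₁ hδfρ₁ (E1 ν)) (hT1b ν)) fun a a' => le_of_eq (by ring)
  -- ENTRY 1*, the LEFT BACKWARD derivative: `∇*_{Ṽ,μ}·G = −σ_{−μ}∇_μ·G + B_μσ_{−μ}·G ≺ (K₀ + K₁)·len·e^{−δ_f d}`
  have hT1s : ∀ μ, HasMajorant (g := toB6 (geoCK i c) Rr H) (blkBK i c) (conj b (mulDefBB i V μ) * (conj b ((shiftOpB' (𝔸 := Matrix (Fin N) (Fin N) ℂ) i μ).restrictScalars ℝ) * G))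
      (fun a a' => K₁ * (geoCK i c).len a * Real.exp (-(δf * (geoCK i c).dist a a'))) := fun μ => by
    refine hasMajorant_mono (g := toB6 (geoCK i c) Rr H) _ (hasMajorant_mul_of_rowLocal (g := toB6 (geoCK i c) Rr H) (blkBK i c)
      (fun a => 2 * ((geoCK i c).len a)⁻¹ * Sb) (hlocB μ) (hσ'G μ)) fun a a' => le_of_eq ?_
    calc 2 * ((geoCK i c).len a)⁻¹ * Sb * (Real.exp ρ₁ * A₁ * Λ4 * c1 ^ 2 * (geoCK i c).len a ^ 2 * Real.exp (-(δf * (geoCK i c).dist a a')))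
        = 2 * Sb * Real.exp ρ₁ * A₁ * Λ4 * c1 ^ 2 * (((geoCK i c).len a)⁻¹ * (geoCK i c).len a ^ 2) * Real.exp (-(δf * (geoCK i c).dist a a')) := by ring
      _ = K₁ * (geoCK i c).len a * Real.exp (-(δf * (geoCK i c).dist a a')) := by rw [hlinv, hK₁def]
  have hEntry1s : ∀ ν, HasMajorant (g := toB6 (geoCK i c) Rr H) (blkBK i c) (conj b (cdsBₗ i V ν) * G)
      (fun a a' => (K₀ + K₁) * (geoCK i c).len a * Real.exp (-(δf * (geoCK i c).dist a a'))) := fun ν => by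
    have e : conj b (cdsBₗ i V ν) * G = -(conj b ((shiftOpB' (𝔸 := Matrix (Fin N) (Fin N) ℂ) i ν).restrictScalars ℝ) * (DK b i ν * G)) +
        conj b (mulDefBB i V ν) * (conj b ((shiftOpB' (𝔸 := Matrix (Fin N) (Fin N) ℂ) i ν).restrictScalars ℝ) * G) := by
      rw [cdsBₗ_eq_add, conj_add', B9Eq352DivFormLetters.conj_mul, cdsBₗ_one_eq_neg, conj_neg, B9Eq352DivFormLetters.conj_mul, conj_cdBₗ_one]
      refine LinearMap.ext fun w => ?_
      simp only [LinearMap.add_apply, LinearMap.neg_apply, Module.End.mul_apply]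
    rw [e]
    refine hasMajorant_mono (g := toB6 (geoCK i c) Rr H) _ (hasMajorant_add (g := toB6 (geoCK i c) Rr H) _
      (hasMajorant_neg (g := toB6 (geoCK i c) Rr H) _ (hσ'DG ν)) (hT1s ν)) fun a a' => le_of_eq (by rw [hK₀def]; ring)
  -- ENTRY 3, the four correction families per direction
  have hT3a : ∀ μ, HasMajorant (g := toB6 (geoCK i c) Rr H) (blkBK i c) (-(conj b (mulDefBF' i V μ) * (DK b i μ * G)))
      (fun a a' => 2 * Sb * A₁ * 1 * Real.exp (-(δf * (geoCK i c).dist a a'))) := fun μ => by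
    refine hasMajorant_neg (g := toB6 (geoCK i c) Rr H) _ (hasMajorant_mono (g := toB6 (geoCK i c) Rr H) _
      (hasMajorant_mul_of_rowLocal (g := toB6 (geoCK i c) Rr H) (blkBK i c) (fun a => 2 * ((geoCK i c).len a)⁻¹ * Sb) (hlocF' μ)
        (hasMajorant_weaken i c Rr H _ hlen0 le_rfl hA₁ hδfρ₁ (E1 μ))) fun a a' => le_of_eq ?_)
    calc 2 * ((geoCK i c).len a)⁻¹ * Sb * (A₁ * (geoCK i c).len a * Real.exp (-(δf * (geoCK i c).dist a a')))
        = 2 * Sb * A₁ * (((geoCK i c).len a)⁻¹ * (geoCK i c).len a) * Real.exp (-(δf * (geoCK i c).dist a a')) := by ring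
      _ = _ := by rw [hlinv1]
  have hT3b : ∀ μ, HasMajorant (g := toB6 (geoCK i c) Rr H) (blkBK i c)
      (conj b ((i.cf : ℝ) • (mulDefBF' i V μ - mulDefBF i V μ)) * (conj b ((shiftOpB (𝔸 := Matrix (Fin N) (Fin N) ℂ) i μ).restrictScalars ℝ) * G))
      (fun a a' => K₁ * 1 * Real.exp (-(δf * (geoCK i c).dist a a'))) := fun μ => by
    refine hasMajorant_mono (g := toB6 (geoCK i c) Rr H) _ (hasMajorant_mul_of_rowLocal (g := toB6 (geoCK i c) Rr H) (blkBK i c)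
      (fun a => 2 * ((geoCK i c).len a ^ 2)⁻¹ * Sb) (hlocE μ) (hσG μ)) fun a a' => le_of_eq ?_
    calc 2 * ((geoCK i c).len a ^ 2)⁻¹ * Sb * (Real.exp ρ₁ * A₁ * Λ4 * c1 ^ 2 * (geoCK i c).len a ^ 2 * Real.exp (-(δf * (geoCK i c).dist a a')))
        = 2 * Sb * Real.exp ρ₁ * A₁ * Λ4 * c1 ^ 2 * (((geoCK i c).len a ^ 2)⁻¹ * (geoCK i c).len a ^ 2) * Real.exp (-(δf * (geoCK i c).dist a a')) := by ring
      _ = K₁ * 1 * Real.exp (-(δf * (geoCK i c).dist a a')) := by rw [hlinv2, hK₁def]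
  have hT3c : ∀ μ, HasMajorant (g := toB6 (geoCK i c) Rr H) (blkBK i c)
      (conj b (mulDefBB i V μ) * (conj b ((shiftOpB' (𝔸 := Matrix (Fin N) (Fin N) ℂ) i μ).restrictScalars ℝ) * (DK b i μ * G)))
      (fun a a' => K₁ * 1 * Real.exp (-(δf * (geoCK i c).dist a a'))) := fun μ => by
    refine hasMajorant_mono (g := toB6 (geoCK i c) Rr H) _ (hasMajorant_mul_of_rowLocal (g := toB6 (geoCK i c) Rr H) (blkBK i c)
      (fun a => 2 * ((geoCK i c).len a)⁻¹ * Sb) (hlocB μ) (hσ'DG μ)) fun a a' => le_of_eq ?_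
    calc 2 * ((geoCK i c).len a)⁻¹ * Sb * (Real.exp ρ₁ * A₁ * Λ4 * c1 ^ 2 * (geoCK i c).len a * Real.exp (-(δf * (geoCK i c).dist a a')))
        = 2 * Sb * Real.exp ρ₁ * A₁ * Λ4 * c1 ^ 2 * (((geoCK i c).len a)⁻¹ * (geoCK i c).len a) * Real.exp (-(δf * (geoCK i c).dist a a')) := by ring
      _ = K₁ * 1 * Real.exp (-(δf * (geoCK i c).dist a a')) := by rw [hlinv1, hK₁def]
  have hT3d : ∀ μ, HasMajorant (g := toB6 (geoCK i c) Rr H) (blkBK i c) (conj b (mulDefBB i V μ) * (conj b (mulDefBF' i V μ) * G))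
      (fun a a' => 4 * Sb ^ 2 * A₁ * 1 * Real.exp (-(δf * (geoCK i c).dist a a'))) := fun μ => by
    have hin : HasMajorant (g := toB6 (geoCK i c) Rr H) (blkBK i c) (conj b (mulDefBF' i V μ) * G)
        (fun a a' => 2 * ((geoCK i c).len a)⁻¹ * Sb * (A₁ * (geoCK i c).len a ^ 2 * Real.exp (-(δf * (geoCK i c).dist a a')))) :=
      hasMajorant_mul_of_rowLocal (g := toB6 (geoCK i c) Rr H) (blkBK i c) (fun a => 2 * ((geoCK i c).len a)⁻¹ * Sb) (hlocF' μ)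
        (hasMajorant_weaken i c Rr H _ hlen2 le_rfl hA₁ hδfρ₁ E0)
    refine hasMajorant_mono (g := toB6 (geoCK i c) Rr H) _ (hasMajorant_mul_of_rowLocal (g := toB6 (geoCK i c) Rr H) (blkBK i c)
      (fun a => 2 * ((geoCK i c).len a)⁻¹ * Sb) (hlocB μ) hin) fun a a' => le_of_eq ?_
    calc 2 * ((geoCK i c).len a)⁻¹ * Sb * (2 * ((geoCK i c).len a)⁻¹ * Sb * (A₁ * (geoCK i c).len a ^ 2 * Real.exp (-(δf * (geoCK i c).dist a a'))))
        = 4 * Sb ^ 2 * A₁ * (((geoCK i c).len a)⁻¹ * (((geoCK i c).len a)⁻¹ * (geoCK i c).len a ^ 2)) * Real.exp (-(δf * (geoCK i c).dist a a')) := by ring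
      _ = 4 * Sb ^ 2 * A₁ * 1 * Real.exp (-(δf * (geoCK i c).dist a a')) := by rw [hlinv, hlinv1]
  -- ENTRY 3, the correction per direction
  have hT3 : ∀ μ, HasMajorant (g := toB6 (geoCK i c) Rr H) (blkBK i c)
      (conj b (-(mulDefBF' i V μ * cdBₗ i (fun _ _ => 1) μ) + ((i.cf : ℝ) • (mulDefBF' i V μ - mulDefBF i V μ)) * (shiftOpB i μ).restrictScalars ℝ +
          mulDefBB i V μ * (shiftOpB' i μ).restrictScalars ℝ * cdBₗ i (fun _ _ => 1) μ + mulDefBB i V μ * mulDefBF' i V μ) * G)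
      (fun a a' => (2 * Sb * A₁ + 2 * K₁ + 4 * Sb ^ 2 * A₁) * 1 * Real.exp (-(δf * (geoCK i c).dist a a'))) := fun μ => by
    have e : conj b (-(mulDefBF' i V μ * cdBₗ i (fun _ _ => 1) μ) + ((i.cf : ℝ) • (mulDefBF' i V μ - mulDefBF i V μ)) * (shiftOpB i μ).restrictScalars ℝ +
          mulDefBB i V μ * (shiftOpB' i μ).restrictScalars ℝ * cdBₗ i (fun _ _ => 1) μ + mulDefBB i V μ * mulDefBF' i V μ) * G =
        -(conj b (mulDefBF' i V μ) * (DK b i μ * G)) +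
          conj b ((i.cf : ℝ) • (mulDefBF' i V μ - mulDefBF i V μ)) * (conj b ((shiftOpB (𝔸 := Matrix (Fin N) (Fin N) ℂ) i μ).restrictScalars ℝ) * G) +
          conj b (mulDefBB i V μ) * (conj b ((shiftOpB' (𝔸 := Matrix (Fin N) (Fin N) ℂ) i μ).restrictScalars ℝ) * (DK b i μ * G)) +
          conj b (mulDefBB i V μ) * (conj b (mulDefBF' i V μ) * G) := by
      rw [conj_add', conj_add', conj_add', conj_neg, B9Eq352DivFormLetters.conj_mul, B9Eq352DivFormLetters.conj_mul, B9Eq352DivFormLetters.conj_mul,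
        B9Eq352DivFormLetters.conj_mul, B9Eq352DivFormLetters.conj_mul, conj_cdBₗ_one]
      refine LinearMap.ext fun w => ?_
      simp only [LinearMap.add_apply, LinearMap.neg_apply, Module.End.mul_apply]
    rw [e]
    refine hasMajorant_mono (g := toB6 (geoCK i c) Rr H) _ (hasMajorant_add (g := toB6 (geoCK i c) Rr H) _
      (hasMajorant_add (g := toB6 (geoCK i c) Rr H) _ (hasMajorant_add (g := toB6 (geoCK i c) Rr H) _ (hT3a μ) (hT3b μ)) (hT3c μ)) (hT3d μ))
      fun a a' => le_of_eq (by ring)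
  -- ENTRY 3 assembled
  have hEntry3 : HasMajorant (g := toB6 (geoCK i c) Rr H) (blkBK i c) (conj b (lapBₗ i V) * G)
      (fun a a' => Bf * 1 * Real.exp (-(δf * (geoCK i c).dist a a'))) := by
    have hop : lapBₗ i V = lapBₗ i (fun _ _ => 1) +
        ∑ μ, (-(mulDefBF' i V μ * cdBₗ i (fun _ _ => 1) μ) + ((i.cf : ℝ) • (mulDefBF' i V μ - mulDefBF i V μ)) * (shiftOpB i μ).restrictScalars ℝ +
          mulDefBB i V μ * (shiftOpB' i μ).restrictScalars ℝ * cdBₗ i (fun _ _ => 1) μ + mulDefBB i V μ * mulDefBF' i V μ) := by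
      rw [lapBₗ_eq_sum, lapBₗ_eq_sum, ← Finset.sum_add_distrib]
      exact Finset.sum_congr rfl fun μ _ => cdsBₗ_mul_cdBₗ_eq i V μ
    have e : conj b (lapBₗ i V) * G = LapK b i * G +
        ∑ μ, conj b (-(mulDefBF' i V μ * cdBₗ i (fun _ _ => 1) μ) + ((i.cf : ℝ) • (mulDefBF' i V μ - mulDefBF i V μ)) * (shiftOpB i μ).restrictScalars ℝ +
          mulDefBB i V μ * (shiftOpB' i μ).restrictScalars ℝ * cdBₗ i (fun _ _ => 1) μ + mulDefBB i V μ * mulDefBF' i V μ) * G := by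
      rw [hop, conj_add', conj_lapBₗ_one, conj_sum', add_mul, Finset.sum_mul]
    rw [e]
    have hsum := hasMajorant_finset_sum (g := toB6 (geoCK i c) Rr H) (blkBK i c) Finset.univ _ _ fun μ _ => hT3 μ
    refine hasMajorant_mono (g := toB6 (geoCK i c) Rr H) _ (hasMajorant_add (g := toB6 (geoCK i c) Rr H) _
      (hasMajorant_weaken i c Rr H (fun _ => (1 : ℝ)) (fun _ => zero_le_one) le_rfl hA₁ hδfρ₁ E3) hsum) fun a a' => ?_
    rw [Finset.sum_const, Finset.card_univ, Fintype.card_fin, nsmul_eq_mul, Nat.cast_add, Nat.cast_one, hBfdef]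
    have hx : 0 ≤ Real.exp (-(δf * (geoCK i c).dist a a')) := Real.exp_nonneg _
    nlinarith
  -- ENTRY 2, the correction `G·B_ν·σ_{−ν} ≺ K₁·len·e^{−δ_f d}` (weighted-kernel∘shift rule)
  have hT2 : ∀ ν, HasMajorant (g := toB6 (geoCK i c) Rr H) (blkBK i c) (G * conj b (mulDefBB i V ν) * conj b ((shiftOpB' (𝔸 := Matrix (Fin N) (Fin N) ℂ) i ν).restrictScalars ℝ))
      (fun a a' => K₁ * (geoCK i c).len a * Real.exp (-(δf * (geoCK i c).dist a a'))) := fun ν => by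
    have hin : HasMajorant (g := toB6 (geoCK i c) Rr H) (blkBK i c) (G * conj b (mulDefBB i V ν))
        (fun a a' => A₁ * (geoCK i c).len a ^ 2 * Real.exp (-(ρ₁ * (geoCK i c).dist a a')) * (2 * Sb * ((geoCK i c).len a')⁻¹)) :=
      hasMajorant_mono (g := toB6 (geoCK i c) Rr H) _ (hasMajorant_mul_of_rowLocal_right (g := toB6 (geoCK i c) Rr H) (blkBK i c)
        (fun a => 2 * ((geoCK i c).len a)⁻¹ * Sb) hcF (hlocB ν) E0) fun a a' => le_of_eq (by ring)
    have hS : HasMajorant (g := toB6 (geoCK i c) Rr H) (blkBK i c) (conj b ((shiftOpB' (𝔸 := Matrix (Fin N) (Fin N) ℂ) i ν).restrictScalars ℝ))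
        (fun a a' => Real.exp ((1 - 9 / 5000) * ρ₁) * Real.exp (-((1 - 9 / 5000) * ρ₁ * (geoCK i c).dist a a'))) :=
      hasMajorant_conj_shiftOpB' i c b Rr H hκρ' ν
    have hout := hasMajorant_weighted_mul_shift i c Rr H (blkBK i c) dB (δ := ρ₁) (α := 9 / 5000) (α' := 9 / 5000) (r := 2 * Sb) (A := A₁) (Λ := Λ4)
      (by positivity) hA₁ hΛ4 hκρ' (by norm_num) htri hPΛ3 h261' hin hS
    refine hasMajorant_mono (g := toB6 (geoCK i c) Rr H) _ hout fun a a' => ?_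
    have hexp1 : Real.exp ((1 - 9 / 5000) * ρ₁) ≤ Real.exp ρ₁ := Real.exp_le_exp.2 (by nlinarith)
    have hrest : 0 ≤ A₁ * (2 * Sb) * Λ4 * c1 ^ 2 * (geoCK i c).len a * Real.exp (-(δf * (geoCK i c).dist a a')) :=
      mul_nonneg (mul_nonneg (mul_nonneg (mul_nonneg (mul_nonneg hA₁ (mul_nonneg (by norm_num) hSb)) hΛ4) (sq_nonneg _)) (hlen0 a)) (Real.exp_nonneg _)
    calc A₁ * (2 * Sb) * Λ4 * Real.exp ((1 - 9 / 5000) * ρ₁) * B6.c1 dB ((1 - 9 / 5000) * ρ₁) (9 / 5000) ^ 2 * (geoCK i c).len a *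
          Real.exp (-((1 - 9 / 5000) * ((1 - 9 / 5000) * ρ₁) * (geoCK i c).dist a a'))
        = Real.exp ((1 - 9 / 5000) * ρ₁) * (A₁ * (2 * Sb) * Λ4 * c1 ^ 2 * (geoCK i c).len a * Real.exp (-(δf * (geoCK i c).dist a a'))) := by
          rw [hc1def, hδfdef]; ring
      _ ≤ Real.exp ρ₁ * (A₁ * (2 * Sb) * Λ4 * c1 ^ 2 * (geoCK i c).len a * Real.exp (-(δf * (geoCK i c).dist a a'))) :=
          mul_le_mul_of_nonneg_right hexp1 hrest
      _ = K₁ * (geoCK i c).len a * Real.exp (-(δf * (geoCK i c).dist a a')) := by rw [hK₁def]; ring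
  -- COLLECT
  have hin : 0 ≤ 2 * Sb * A₁ + 2 * K₁ + 4 * Sb ^ 2 * A₁ := by
    have h1 := mul_nonneg hSb hA₁; have h2 := mul_nonneg (sq_nonneg Sb) hA₁; linarith
  have hD : 0 ≤ ((d : ℝ) + 1) * (2 * Sb * A₁ + 2 * K₁ + 4 * Sb ^ 2 * A₁) := mul_nonneg (by positivity) hin
  have hle1 : A₁ + K₁ ≤ Bf := by rw [hBfdef]; linarith
  have hleB : K₀ + K₁ ≤ Bf := by rw [hBfdef]; linarith
  have hleK : K₁ ≤ Bf := by rw [hBfdef]; linarith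
  have hleA : A₁ ≤ Bf := by rw [hBfdef]; linarith
  refine ⟨hunit, hasMajorant_weaken i c Rr H _ hlen2 hleA hBf' hδfρ₁ E0, fun ν => hasMajorant_weaken i c Rr H _ hlen0 hle1 hBf' le_rfl (hEntry1 ν),
    fun ν => hasMajorant_weaken i c Rr H _ hlen0 hleB hBf' le_rfl (hEntry1s ν), hEntry3, fun ν B₂ ρ' hB₂ hρ' hρ'δ hR => ?_⟩
  have e : G * conj b (cdsBₗ i V ν) = G * conj b (cdsBₗ i (fun _ _ => (1 : (Matrix (Fin N) (Fin N) ℂ)ˣ)) ν) +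
      G * conj b (mulDefBB i V ν) * conj b ((shiftOpB' (𝔸 := Matrix (Fin N) (Fin N) ℂ) i ν).restrictScalars ℝ) := by
    rw [cdsBₗ_eq_add, conj_add', B9Eq352DivFormLetters.conj_mul, mul_add, mul_assoc]
  rw [e]
  refine hasMajorant_mono (g := toB6 (geoCK i c) Rr H) _ (hasMajorant_add (g := toB6 (geoCK i c) Rr H) _ hR
    (hasMajorant_weaken i c Rr H _ hlen0 hleK hBf' hρ'δ (hT2 ν))) fun a a' => le_of_eq (by ring)

set_option maxHeartbeats 1000000 in
/-- ★★★ **COROLLARY 3.6 AT ONE COVER CUBE FOR THE DIRICHLET BOND LETTER OF RECORD — THE (3.42) ENTRIES OF `G := conj b(G_□(Ṽ)♯ℝ)` WITH THE COVARIANT DERIVATIVES AT THE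
SHARP-CUT FIELD `Ṽ = cutCfgS i T η A`, BOTH LEFT FIRST-ORDER ENTRIES, THE LAPLACIAN ENTRY, AND THE RIGHT ENTRY MODULO ITS FLAT HALF** (see the module doc); F4's hypothesis
list verbatim, thresholds and `a₁` re-chosen. [cite: Balaban1985BackgroundPropagators, Cor. 3.6 p.408 l.1–10, Thm 3.3 p.399, Thm 3.1 (3.42) p.397, Thm 3.4 p.400, p.403 l.1–9, (3.70) p.404, (3.100) p.413, p.409 l.1–5; Balaban1984PropagatorsII, (2.51)–(2.55) pp.232–233, Lemma 2.1 (2.60)–(2.63) p.234, Prop. 2.6 (2.136) p.247, p.248 l.4–5] -/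
theorem gDir_knit_entries_at_cutField
    (h26 : B6.Prop26DirichletPrinted (geoDirBI (d := d) (ℓ := ℓ) (hd := hd) (hL := hL) (b₀ := b₀) (b₁ := b₁)) domDirBI admDirBI GDirBFam)
    (hℓ : 1 ≤ ℓ) (hb₀ : 0 < b₀) (hb₁ : b₀ ≤ b₁) (M₂ : ℝ) (hM₂ : 0 ≤ M₂) (hrepr : ∀ (v : Matrix (Fin N) (Fin N) ℂ) (j : ι), |b.repr v j| ≤ M₂ * ‖v‖)
    {α₀ α₀' ϱ' ϱ : ℝ} (hα₀ : 0 < α₀) (hα' : 0 < α₀') (hα3 : C0 (d + 1) * α₀' ≤ 1 / 3) (hα8 : 8 * α₀' ≤ c2' (d + 1) (ℓ + 1))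
    (hϱ' : 0 < ϱ') (hϱ : 0 < ϱ)
    (hsmall' : Real.exp (4 * (800 * (((d + 1 : ℕ) : ℝ) + 1) ^ 2 * (((d + 1 : ℕ) : ℝ) + 4)) * α₀') * (1 + 8 * (131072 * (((d + 1 : ℕ) : ℝ) + 1) ^ 2) * ϱ') ≤ 2)
    (hc₃' : 2 * ϱ' ≤ c3 (d + 1) (ℓ + 1)) (hϱ'1 : 409600 * (((d + 1 : ℕ) : ℝ) + 1) ^ 2 * ϱ' ≤ 1)
    (hE : epsCplx (d + 1) (ℓ + 1) ϱ' 0 ≤ 1 / 16)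
    (hdX : ((d + 1 : ℕ) : ℝ) * (epsCplx (d + 1) (ℓ + 1) ϱ' 0 + tauCplx (d + 1) (ℓ + 1) α₀' 0 ϱ' 0) ≤ 1 / 16)
    (hsmallJ : Real.exp (4480 * (((d + 1 : ℕ) : ℝ) + 1) ^ 2 * (((d + 1 : ℕ) : ℝ) + 4) * α₀' + 240000 * (((d + 1 : ℕ) : ℝ) + 1) ^ 3 * ϱ') *
      (1 + 8 * (2097152 * (((d + 1 : ℕ) : ℝ) + 1) ^ 2) * ϱ) ≤ 2)
    (hc₃J : 2 * ϱ ≤ c3 (d + 1) (ℓ + 1) / 4) :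
    ∃ δ Bf M₀ T₀ : ℝ, ∃ N₀ : ℕ, 0 < δ ∧ 0 ≤ Bf ∧ ∃ a₁ : ℝ, 0 < a₁ ∧
    ∀ (i : KIdx d ℓ hd hL b₀ b₁) (c : ↥(cubes (toKT i).D.toDomains)) (Rr : ℝ) (H : Prop),
      M₀ ≤ ((ℓ : ℝ) + 1) * (toKT i).Mh → N₀ + 1 ≤ (toKT i).R * ((ℓ + 1) * (toKT i).Mh) → T₀ ≤ RM1 i →
      0 ≤ (kGeo i).M * α₀ → Kpl i ((kGeo i).M * α₀) * (kGeo i).L ^ 4 < α₀' →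
    ∀ (KB : Matrix (FBondY i) (FBondY i) ℝ),
      (mDirC i c).submatrix (fun v : ↥(bondsOverY i (dirDomY i c)) => (v : FBondY i)) (fun v : ↥(bondsOverY i (dirDomY i c)) => (v : FBondY i)) *
        KB.submatrix (fun v : ↥(bondsOverY i (dirDomY i c)) => (v : FBondY i)) (fun v : ↥(bondsOverY i (dirDomY i c)) => (v : FBondY i)) = 1 →
    ∀ (T : Finset (SiteY i)) (A : AfldY (Matrix (Fin N) (Fin N) ℂ) i) (Q : Set (Site (PV d ℓ i.m i.K hd hL) 0)) (C ξ Λ : ℝ),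
      0 ≤ C → (kGeo i).eta ≤ ξ → 1 ≤ Λ → LatticeNorms.scaleLen ((ℓ : ℝ) + 1) (kGeo i).eta (c.1.1 + 1) ≤ Λ * ξ →
      (∀ z ∈ dirDomY i c, z ∈ T) → (∀ z ∈ T, (boxEquiv i.hN).symm z ∈ Q) →
      (∀ κ, ∀ x ∈ Q, ‖A κ x‖ ≤ C * ξ⁻¹) →
      (∀ μ ν, ∀ x ∈ Q, ‖(((kGeo i).eta : ℂ)⁻¹) • covD (shiftsV1 (PV d ℓ i.m i.K hd hL)) (fun _ _ => (1 : (Matrix (Fin N) (Fin N) ℂ)ˣ)) μ (A ν) x‖ ≤ C * (ξ ^ 2)⁻¹) →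
      (∀ z : SiteY i, 1 ≤ levCubeY i c z → z ∈ dirDomY i c ∧ ∀ μ, shiftY i μ z ∈ dirDomY i c ∧ (shiftY i μ).symm z ∈ dirDomY i c ∧
        ∀ ν, shiftY i ν (shiftY i μ z) ∈ dirDomY i c ∧ shiftY i ν ((shiftY i μ).symm z) ∈ dirDomY i c ∧ (shiftY i ν).symm ((shiftY i μ).symm z) ∈ dirDomY i c) →
      2 * C * Λ ^ 2 ≤ a₁ → 3 * (2 * C * Λ ^ 2) ≤ ϱ' →
      4 * α₀' ≤ c2' (d + 1) (ℓ + 1) →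
      Real.exp (4 * (800 * (((d + 1 : ℕ) : ℝ) + 1) ^ 2 * (((d + 1 : ℕ) : ℝ) + 4)) * α₀') * (1 + 8 * (131072 * (((d + 1 : ℕ) : ℝ) + 1) ^ 2) * (2 * C * Λ ^ 2)) ≤ 2 →
      2 * (2 * C * Λ ^ 2) ≤ c3 (d + 1) (ℓ + 1) → 4096 * ((d + 1 : ℕ) : ℝ) * (2 * C * Λ ^ 2) ≤ 1 →
      (∀ μ x, ‖(cutCfgS i T (kGeo i).eta A μ x : Matrix (Fin N) (Fin N) ℂ)‖ ≤ 1 ∧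
        ‖(((cutCfgS i T (kGeo i).eta A μ x)⁻¹ : (Matrix (Fin N) (Fin N) ℂ)ˣ) : Matrix (Fin N) (Fin N) ℂ)‖ ≤ 1) →
      IsUnit (padDeltaLocCY i c (QknitCubeY i c) (QsknitCubeY i c) (DPDsDirCubeY i c (dirDomY i c)) (bondsOverY i (dirDomY i c)) (cutCfgS i T (kGeo i).eta A)) ∧
      HasMajorant (g := toB6 (geoCK i c) Rr H) (blkBK i c) (GiK b i (TKnitCY i c (cutCfgS i T (kGeo i).eta A)) (bondsOverY i (dirDomY i c)))
        (fun a a' => Bf * (geoCK i c).len a ^ 2 * Real.exp (-(δ * (geoCK i c).dist a a'))) ∧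
      (∀ ν : Fin (d + 1), HasMajorant (g := toB6 (geoCK i c) Rr H) (blkBK i c)
        (conj b (cdBₗ i (cutCfgS i T (kGeo i).eta A) ν) * GiK b i (TKnitCY i c (cutCfgS i T (kGeo i).eta A)) (bondsOverY i (dirDomY i c)))
        (fun a a' => Bf * (geoCK i c).len a * Real.exp (-(δ * (geoCK i c).dist a a')))) ∧
      (∀ ν : Fin (d + 1), HasMajorant (g := toB6 (geoCK i c) Rr H) (blkBK i c)
        (conj b (cdsBₗ i (cutCfgS i T (kGeo i).eta A) ν) * GiK b i (TKnitCY i c (cutCfgS i T (kGeo i).eta A)) (bondsOverY i (dirDomY i c)))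
        (fun a a' => Bf * (geoCK i c).len a * Real.exp (-(δ * (geoCK i c).dist a a')))) ∧
      HasMajorant (g := toB6 (geoCK i c) Rr H) (blkBK i c)
        (conj b (lapBₗ i (cutCfgS i T (kGeo i).eta A)) * GiK b i (TKnitCY i c (cutCfgS i T (kGeo i).eta A)) (bondsOverY i (dirDomY i c)))
        (fun a a' => Bf * 1 * Real.exp (-(δ * (geoCK i c).dist a a'))) ∧
      (∀ (ν : Fin (d + 1)) (B₂ ρ' : ℝ), 0 ≤ B₂ → 0 ≤ ρ' → ρ' ≤ δ →
        HasMajorant (g := toB6 (geoCK i c) Rr H) (blkBK i c)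
          (GiK b i (TKnitCY i c (cutCfgS i T (kGeo i).eta A)) (bondsOverY i (dirDomY i c)) * conj b (cdsBₗ i (fun _ _ => (1 : (Matrix (Fin N) (Fin N) ℂ)ˣ)) ν))
          (fun a a' => B₂ * (geoCK i c).len a * Real.exp (-(ρ' * (geoCK i c).dist a a'))) →
        HasMajorant (g := toB6 (geoCK i c) Rr H) (blkBK i c)
          (GiK b i (TKnitCY i c (cutCfgS i T (kGeo i).eta A)) (bondsOverY i (dirDomY i c)) * conj b (cdsBₗ i (cutCfgS i T (kGeo i).eta A) ν))
          (fun a a' => (B₂ + Bf) * (geoCK i c).len a * Real.exp (-(ρ' * (geoCK i c).dist a a')))) := by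
  obtain ⟨δ, Bf, M₀, T₀, N₀, hδ, hBf, a₁, ha₁, h⟩ := gDir_knit_entries_at_cutFieldU b h26 hℓ hb₀ hb₁ M₂ hM₂ hrepr hα' hα3 hα8 hϱ' hϱ hsmall' hc₃' hϱ'1 hE hdX
    hsmallJ hc₃J
  exact ⟨δ, Bf, M₀, T₀, N₀, hδ, hBf, a₁, ha₁, fun i c Rr H hM hN hT hMα hKpl => h i c Rr H hM hN hT α₀ hα₀ hMα hKpl⟩

end Main

end Literature.MathematicalPhysics.QuantumFieldTheory.Balaban1983to89.B9Cor36GDirKnitEntriesAtCutField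

end
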